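import Summits.Ventures.DiscreteObjects.Hadamard.FixedRowsOrbitTools

/-!
# Hadamard matrices of order 4q (q ≥ 5 prime): an automorphism of order q is fixed-point-free with 4 + 4 orbits (kernel)

Framing: lottery ticket; floor = certified bounds/negative ranges.

Cell pub-namedobj (venture DiscreteObjects), target (H), hadamard gen 9.  Generalisation of `PrimeOrder167` (H(668), q = 167)
to every order `4q` with `q ≥ 5` prime — in particular to the three open orders `668 = 4·167`, `716 = 4·179`, `892 = 4·223`
below 1000: **`hadamard4q_fixedRows` — a signed-permutation automorphism `(π, κ, d, e)` of a Hadamard matrix of order `4q`,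
`q ≥ 5` prime, with `π^q = κ^q = 1` and `(π, κ) ≠ (1, 1)` fixes NO row and NO column; `π` and `κ` have exactly four orbits of
length `q`.**  (For `q = 3` the statement is false: H(12) has automorphisms of order 3 with three fixed points.)  So such a
matrix is a `4 × 4` array of `q × q` blocks on which `Z_q` acts regularly on rows and columns — the shape of the classical
four-circulant-block families — and its orbit matrix is a `4 × 4` odd-integer matrix `A` with `A Aᵀ = 4q·I₄`.
Proof as in `PrimeOrder167` with `167 ↦ q`: `f + q·w = 4q` fixed columns/classes; for two fixed rows the row product is constant
on classes (`fixedRows_split`); five fixed rows are contradictory for each `w ∈ {1,2,3,4}` (PSD sum `5·3q − 20·q < 0`; parity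
classes of size ≤ 2; rigidity `S = ±q` plus four pairwise orthogonal sign vectors; four pairwise orthogonal sign vectors —
`card_le_of_pairwise_orthogonal`); `w = 0` forces `κ = 1` hence `π = 1`; so the number of fixed rows is `≤ 4` and a multiple
`(4 − w)·q` of `q ≥ 5`, i.e. `0`.  Print status: for specific small orders such statements occur in the classification
literature (e.g. order 28 with automorphisms of order 7); the uniform statement is recorded here as ours/folklore, machine-checked.
No `sorry`.  PRINT STATUS (lead F-H8, 2026-08-21): the uniform statement is KNOWN — Tonchev 1985, §2 (Lemma 2.1: no
Hadamard 3-(4t+4, 2t+2, t) design with t > 2, t+1 prime, admits an automorphism of order t+1; corollary: for a prime p > 3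
an automorphism of order p of a Hadamard matrix of order 4p fixes no row and no column, and the matrix is equivalent to a
4 × 4 array of p × p circulants) [cite: Tonchev1985, §2].  This file gives an independent machine-checked elementary proof;
no novelty is claimed for the statement.
-/

open Finset BigOperators Matrix

namespace Summit.Ventures.DiscreteObjects.Hadamard

open Literature.Combinatorics.Designs.GoethalsSeidel (IsHadamardMatrix)

variable {ι : Type*} [Fintype ι] [DecidableEq ι]

section order4q

variable {H : Matrix ι ι ℤ} {π κ : Equiv.Perm ι} {d e : ι → ℤ} {q : ℕ}

/-- the product of two entries is `±1` -/
private lemma entryProd_pm' (hH : IsHadamardMatrix H) (i i' j j' : ι) :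
    H i j * H i' j' = 1 ∨ H i j * H i' j' = -1 := by
  rcases hH.1 i j with h | h <;> rcases hH.1 i' j' with h' | h' <;> simp [h, h']

/-- **Case `w = 4` (no fixed column): five fixed rows are impossible.** -/
private lemma case_four' (hH : IsHadamardMatrix H) (haut : IsSignedAut H π κ d e) (hq : q.Prime) (hodd : Odd q)
    (hκ : κ ^ q = 1) (uu : Fin 5 → ι) (huu : Function.Injective uu) (hfix : ∀ i, π (uu i) = uu i)
    (rep : Finset ι → ι) (hrep : ∀ C ∈ blockClasses κ q, rep C ∈ C)
    (hk : (blockClasses κ q).card = 4) (hf : (univ.filter fun j => κ j = j).card = 0) : False := by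
  have hq0 : (q : ℤ) ≠ 0 := by exact_mod_cast hq.ne_zero
  have hempty : (univ.filter fun j => κ j = j) = ∅ := Finset.card_eq_zero.mp hf
  have hT : ∀ i i', i ≠ i' → ∑ C ∈ blockClasses κ q, H (uu i) (rep C) * H (uu i') (rep C) = 0 := by
    intro i i' hii'
    have hs := fixedRows_split hH haut hq hodd hκ (hfix i) (hfix i') (huu.ne hii') rep hrep
    rw [hempty, Finset.sum_empty, zero_add] at hs
    exact (mul_eq_zero.mp hs).resolve_left hq0
  let v : Fin 5 → {C // C ∈ blockClasses κ q} → ℚ := fun i C => (H (uu i) (rep C.1) : ℚ)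
  have horth : ∀ i i', i ≠ i' → ∑ C, v i C * v i' C = 0 := by
    intro i i' hii'
    have h1 : ∑ C : {C // C ∈ blockClasses κ q}, v i C * v i' C =
        ∑ C ∈ blockClasses κ q, ((H (uu i) (rep C) * H (uu i') (rep C) : ℤ) : ℚ) := by
      rw [← Finset.sum_coe_sort (blockClasses κ q)]
      simp [v]
    rw [h1, ← Int.cast_sum, hT i i' hii', Int.cast_zero]
  obtain ⟨C₀, hC₀⟩ : (blockClasses κ q).Nonempty := Finset.card_pos.mp (by rw [hk]; norm_num)
  have hnz : ∀ i, ∃ C, v i C ≠ 0 := by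
    intro i
    refine ⟨⟨C₀, hC₀⟩, ?_⟩
    rcases hH.1 (uu i) (rep C₀) with h | h <;> simp [v, h]
  have hle := card_le_of_pairwise_orthogonal v hnz horth
  rw [Fintype.card_coe, hk] at hle
  omega

/-- **Case `w = 3` (`q` fixed columns): five fixed rows are impossible.** -/
private lemma case_three' (hH : IsHadamardMatrix H) (haut : IsSignedAut H π κ d e) (hq : q.Prime) (hodd : Odd q)
    (hκ : κ ^ q = 1) (uu : Fin 5 → ι) (huu : Function.Injective uu) (hfix : ∀ i, π (uu i) = uu i)
    (rep : Finset ι → ι) (hrep : ∀ C ∈ blockClasses κ q, rep C ∈ C)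
    (hk : (blockClasses κ q).card = 3) (hf : (univ.filter fun j => κ j = j).card = q) : False := by
  set Fc := (univ.filter fun j => κ j = j) with hFc
  have hqpos : (0 : ℤ) < q := by exact_mod_cast hq.pos
  obtain ⟨m, hm⟩ := hodd
  have key : ∀ i i', i ≠ i' →
      ∀ j ∈ Fc, H (uu i) j * H (uu i') j = -∑ C ∈ blockClasses κ q, H (uu i) (rep C) * H (uu i') (rep C) := by
    intro i i' hii'
    have hs := fixedRows_split hH haut hq ⟨m, hm⟩ hκ (hfix i) (hfix i') (huu.ne hii') rep hrep
    have hpm : ∀ j ∈ Fc, H (uu i) j * H (uu i') j = 1 ∨ H (uu i) j * H (uu i') j = -1 :=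
      fun j _ => entryProd_pm' hH _ _ _ _
    have habs := abs_sum_pm_le_card Fc (fun j => H (uu i) j * H (uu i') j) hpm
    have hpar := two_dvd_sum_pm_sub_card Fc (fun j => H (uu i) j * H (uu i') j) hpm
    rw [hf] at habs hpar
    obtain ⟨c, hc⟩ := hpar
    have hb := abs_le.mp habs
    set S := ∑ j ∈ Fc, H (uu i) j * H (uu i') j with hS
    set T := ∑ C ∈ blockClasses κ q, H (uu i) (rep C) * H (uu i') (rep C) with hTdef
    -- S = -q T, |S| ≤ q, S odd (q odd) ⇒ T = ±1
    have hSq : S = -(q : ℤ) * T := by linarith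
    have hT : T = 1 ∨ T = -1 := by
      have hT0 : T ≠ 0 := by
        intro h0
        rw [h0, mul_zero] at hSq
        have : (S : ℤ) - q = 2 * c := by linarith
        omega
      rcases lt_trichotomy T 0 with hlt | heq | hgt
      · right
        by_contra hne
        have hle : T ≤ -2 := by omega
        have : (q : ℤ) * T ≤ (q : ℤ) * (-2) := mul_le_mul_of_nonneg_left hle hqpos.le
        linarith [hb.1, hb.2]
      · exact absurd heq hT0
      · left
        by_contra hne
        have hle : 2 ≤ T := by omega
        have : (q : ℤ) * 2 ≤ (q : ℤ) * T := mul_le_mul_of_nonneg_left hle hqpos.le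
        linarith [hb.1, hb.2]
    rcases hT with hT1 | hT1
    · have hSv : S = -(Fc.card : ℤ) := by rw [hf, hSq, hT1, mul_one]
      intro j hj
      rw [hT1]
      exact pm_eq_neg_one_of_sum_eq_neg_card Fc _ hpm hSv j hj
    · have hSv : S = (Fc.card : ℤ) := by rw [hf, hSq, hT1]; ring
      intro j hj
      rw [hT1]
      have := pm_eq_one_of_sum_eq_card Fc _ hpm hSv j hj
      simpa using this
  obtain ⟨jstar, hjstar⟩ : Fc.Nonempty := Finset.card_pos.mp (by rw [hf]; exact hq.pos)
  let v : Fin 5 → Option {C // C ∈ blockClasses κ q} → ℚ := fun i x =>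
    match x with
    | none => (H (uu i) jstar : ℚ)
    | some C => (H (uu i) (rep C.1) : ℚ)
  have horth : ∀ i i', i ≠ i' → ∑ x, v i x * v i' x = 0 := by
    intro i i' hii'
    have h0 := key i i' hii' jstar hjstar
    rw [Fintype.sum_option]
    have h1 : ∑ C : {C // C ∈ blockClasses κ q}, v i (some C) * v i' (some C) =
        ((∑ C ∈ blockClasses κ q, H (uu i) (rep C) * H (uu i') (rep C) : ℤ) : ℚ) := by
      rw [Int.cast_sum, ← Finset.sum_coe_sort (blockClasses κ q)]
      simp [v]
    rw [h1]
    have h2 : v i none * v i' none = ((H (uu i) jstar * H (uu i') jstar : ℤ) : ℚ) := by simp [v]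
    rw [h2, h0]
    push_cast
    ring
  have hnz : ∀ i, ∃ x, v i x ≠ 0 := by
    intro i
    refine ⟨none, ?_⟩
    rcases hH.1 (uu i) jstar with h | h <;> simp [v, h]
  have hle := card_le_of_pairwise_orthogonal v hnz horth
  rw [Fintype.card_option, Fintype.card_coe, hk] at hle
  omega

/-- **Case `w = 2` (`2q` fixed columns): five fixed rows are impossible.** -/
private lemma case_two' (hH : IsHadamardMatrix H) (haut : IsSignedAut H π κ d e) (hq : q.Prime) (hodd : Odd q)
    (hκ : κ ^ q = 1) (uu : Fin 5 → ι) (huu : Function.Injective uu) (hfix : ∀ i, π (uu i) = uu i)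
    (rep : Finset ι → ι) (hrep : ∀ C ∈ blockClasses κ q, rep C ∈ C)
    (hk : (blockClasses κ q).card = 2) (hf : (univ.filter fun j => κ j = j).card = 2 * q) : False := by
  set Fc := (univ.filter fun j => κ j = j) with hFc
  obtain ⟨C₁, C₂, hC12, hcls⟩ := Finset.card_eq_two.mp hk
  let ψ₁ : Fin 5 → ℤ := fun i => H (uu i) (rep C₁)
  let ψ₂ : Fin 5 → ℤ := fun i => H (uu i) (rep C₂)
  let par : Fin 5 → ℤ := fun i => ψ₁ i * ψ₂ i
  have hψ₁ : ∀ i, ψ₁ i = 1 ∨ ψ₁ i = -1 := fun i => hH.1 _ _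
  have hψ₂ : ∀ i, ψ₂ i = 1 ∨ ψ₂ i = -1 := fun i => hH.1 _ _
  have hpar : ∀ i ∈ (univ : Finset (Fin 5)), par i ∈ ({1, -1} : Finset ℤ) := by
    intro i _
    rcases hψ₁ i with h | h <;> rcases hψ₂ i with h' | h' <;> simp [par, h, h']
  have rigid : ∀ a b, a ≠ b → par a = par b → ∀ j ∈ Fc, H (uu a) j * H (uu b) j = -(ψ₁ a * ψ₁ b) := by
    intro a b hab hpab
    have hs := fixedRows_split hH haut hq hodd hκ (hfix a) (hfix b) (huu.ne hab) rep hrep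
    rw [hcls, Finset.sum_pair hC12] at hs
    have hpm : ∀ j ∈ Fc, H (uu a) j * H (uu b) j = 1 ∨ H (uu a) j * H (uu b) j = -1 :=
      fun j _ => entryProd_pm' hH _ _ _ _
    have h2 : ψ₂ a * ψ₂ b = ψ₁ a * ψ₁ b := by
      have e1 : ψ₂ a = par a * ψ₁ a := by
        rcases hψ₁ a with h | h <;> simp [par, h]
      have e2 : ψ₂ b = par b * ψ₁ b := by
        rcases hψ₁ b with h | h <;> simp [par, h]
      rw [e1, e2, hpab]
      have : par b * par b = 1 := by rcases hψ₁ b with h | h <;> rcases hψ₂ b with h' | h' <;> simp [par, h, h']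
      calc par b * ψ₁ a * (par b * ψ₁ b) = (par b * par b) * (ψ₁ a * ψ₁ b) := by ring
        _ = ψ₁ a * ψ₁ b := by rw [this, one_mul]
    set S := ∑ j ∈ Fc, H (uu a) j * H (uu b) j with hS
    change S + (q : ℕ) * (ψ₁ a * ψ₁ b + ψ₂ a * ψ₂ b) = 0 at hs
    rw [h2] at hs
    rcases entryProd_pm' hH (uu a) (uu b) (rep C₁) (rep C₁) with hτ | hτ
    · have hτ' : ψ₁ a * ψ₁ b = 1 := hτ
      have hSv : S = -(Fc.card : ℤ) := by rw [hf]; push_cast; rw [hτ'] at hs; linarith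
      intro j hj
      rw [hτ']
      exact pm_eq_neg_one_of_sum_eq_neg_card Fc _ hpm hSv j hj
    · have hτ' : ψ₁ a * ψ₁ b = -1 := hτ
      have hSv : S = (Fc.card : ℤ) := by rw [hf]; push_cast; rw [hτ'] at hs; linarith
      intro j hj
      rw [hτ']
      have := pm_eq_one_of_sum_eq_card Fc _ hpm hSv j hj
      simpa using this
  have hcardt : ({1, -1} : Finset ℤ).card * 2 < (univ : Finset (Fin 5)).card := by
    rw [Finset.card_univ, Fintype.card_fin]
    have : ({1, -1} : Finset ℤ).card ≤ 2 := Finset.card_le_two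
    omega
  obtain ⟨y, -, hy⟩ := Finset.exists_lt_card_fiber_of_mul_lt_card_of_maps_to hpar hcardt
  obtain ⟨t3, ht3, ht3c⟩ := Finset.exists_subset_card_eq (show 3 ≤ (univ.filter fun i => par i = y).card by omega)
  obtain ⟨x, yy, z, hxy, hxz, hyz, ht3eq⟩ := Finset.card_eq_three.mp ht3c
  have hmem : ∀ a ∈ t3, par a = y := fun a ha => (Finset.mem_filter.mp (ht3 ha)).2
  have hx : par x = y := hmem x (by rw [ht3eq]; simp)
  have hyy : par yy = y := hmem yy (by rw [ht3eq]; simp)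
  have hz : par z = y := hmem z (by rw [ht3eq]; simp)
  obtain ⟨jstar, hjstar⟩ : Fc.Nonempty := Finset.card_pos.mp (by rw [hf]; have := hq.pos; omega)
  have e1 := rigid x yy hxy (by rw [hx, hyy]) jstar hjstar
  have e2 := rigid x z hxz (by rw [hx, hz]) jstar hjstar
  have e3 := rigid yy z hyz (by rw [hyy, hz]) jstar hjstar
  have gx := hH.1 (uu x) jstar
  have gy := hH.1 (uu yy) jstar
  have gz := hH.1 (uu z) jstar
  have qx := hψ₁ x
  have qy := hψ₁ yy
  have qz := hψ₁ z
  simp only [ψ₁] at e1 e2 e3 qx qy qz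
  generalize H (uu x) jstar = a at e1 e2 gx
  generalize H (uu yy) jstar = b at e1 e3 gy
  generalize H (uu z) jstar = c at e2 e3 gz
  generalize H (uu x) (rep C₁) = a' at e1 e2 qx
  generalize H (uu yy) (rep C₁) = b' at e1 e3 qy
  generalize H (uu z) (rep C₁) = c' at e2 e3 qz
  rcases gx with rfl | rfl <;> rcases gy with rfl | rfl <;> rcases gz with rfl | rfl <;>
    rcases qx with rfl | rfl <;> rcases qy with rfl | rfl <;> rcases qz with rfl | rfl <;> omega

/-- **Case `w = 1` (`3q` fixed columns): five fixed rows are impossible.** -/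
private lemma case_one' (hH : IsHadamardMatrix H) (haut : IsSignedAut H π κ d e) (hq : q.Prime) (hodd : Odd q)
    (hκ : κ ^ q = 1) (uu : Fin 5 → ι) (huu : Function.Injective uu) (hfix : ∀ i, π (uu i) = uu i)
    (rep : Finset ι → ι) (hrep : ∀ C ∈ blockClasses κ q, rep C ∈ C)
    (hk : (blockClasses κ q).card = 1) (hf : (univ.filter fun j => κ j = j).card = 3 * q) : False := by
  set Fc := (univ.filter fun j => κ j = j) with hFc
  have hqpos : (0 : ℤ) < q := by exact_mod_cast hq.pos
  obtain ⟨C₁, hcls⟩ := Finset.card_eq_one.mp hk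
  let ψ : Fin 5 → ℤ := fun i => H (uu i) (rep C₁)
  have hψ : ∀ i, ψ i * ψ i = 1 := fun i => pm_mul_self (hH.1 _ _)
  let c : Fin 5 → Fin 5 → ℤ := fun i i' => ∑ j ∈ Fc, (ψ i * H (uu i) j) * (ψ i' * H (uu i') j)
  have hc : ∀ i i', c i i' = -(q : ℤ) + (if i = i' then 4 * (q : ℤ) else 0) := by
    intro i i'
    have hci : c i i' = ψ i * ψ i' * ∑ j ∈ Fc, H (uu i) j * H (uu i') j := by
      simp only [c, Finset.mul_sum]
      apply Finset.sum_congr rfl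
      intro j _
      ring
    by_cases hii' : i = i'
    · subst hii'
      rw [if_pos rfl, hci, hψ i, one_mul]
      calc ∑ j ∈ Fc, H (uu i) j * H (uu i) j = ∑ j ∈ Fc, (1 : ℤ) :=
            Finset.sum_congr rfl (fun j _ => pm_mul_self (hH.1 _ _))
        _ = -(q : ℤ) + 4 * q := by rw [Finset.sum_const, nsmul_eq_mul, mul_one, hf]; push_cast; ring
    · rw [if_neg hii', hci, add_zero]
      have hs := fixedRows_split hH haut hq hodd hκ (hfix i) (hfix i') (huu.ne hii') rep hrep
      rw [hcls, Finset.sum_singleton] at hs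
      have hS : ∑ j ∈ Fc, H (uu i) j * H (uu i') j = -(q : ℤ) * (ψ i * ψ i') := by
        simp only [ψ]; linarith
      rw [hS]
      calc ψ i * ψ i' * (-(q : ℤ) * (ψ i * ψ i')) = -(q : ℤ) * ((ψ i * ψ i) * (ψ i' * ψ i')) := by ring
        _ = -(q : ℤ) := by rw [hψ i, hψ i', mul_one, mul_one]
  have hQ : (0 : ℤ) ≤ ∑ j ∈ Fc, (∑ i, ψ i * H (uu i) j) * (∑ i, ψ i * H (uu i) j) :=
    Finset.sum_nonneg (fun j _ => mul_self_nonneg _)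
  have hQ' : ∑ j ∈ Fc, (∑ i, ψ i * H (uu i) j) * (∑ i, ψ i * H (uu i) j) = ∑ i, ∑ i', c i i' := by
    simp only [c]
    simp_rw [Finset.sum_mul_sum]
    rw [Finset.sum_comm]
    apply Finset.sum_congr rfl
    intro i _
    rw [Finset.sum_comm]
  have hval : ∑ i : Fin 5, ∑ i' : Fin 5, (-(q : ℤ) + (if i = i' then 4 * (q : ℤ) else 0)) = -(5 * (q : ℤ)) := by
    simp only [Finset.sum_add_distrib, Finset.sum_const, Finset.card_univ, Fintype.card_fin, Finset.sum_ite_eq,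
      Finset.mem_univ, if_true]
    ring
  rw [hQ'] at hQ
  simp only [hc] at hQ
  rw [hval] at hQ
  linarith

/-- **At most four fixed rows** once `κ` has at least one class of moved columns (order `q`, Hadamard matrix of order `4q`). -/
theorem hadamard4q_fixedRows_le_four (hH : IsHadamardMatrix H) (hq : q.Prime) (hq3 : 3 ≤ q)
    (hι : Fintype.card ι = 4 * q) (haut : IsSignedAut H π κ d e) (hκ : κ ^ q = 1) (hw : 1 ≤ (blockClasses κ q).card) :
    (univ.filter fun i => π i = i).card ≤ 4 := by
  have hodd : Odd q := hq.odd_of_ne_two (by omega)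
  by_contra hlt
  obtain ⟨t, ht, htc⟩ := Finset.exists_subset_card_eq (show 5 ≤ (univ.filter fun i => π i = i).card by omega)
  let eqv := Finset.equivFinOfCardEq htc
  let uu : Fin 5 → ι := fun i => (eqv.symm i).1
  have huu : Function.Injective uu := by
    intro a b h
    exact eqv.symm.injective (Subtype.ext h)
  have hfix : ∀ i, π (uu i) = uu i := fun i => (Finset.mem_filter.mp (ht (eqv.symm i).2)).2
  have hne_cls : ∀ C ∈ blockClasses κ q, C.Nonempty := fun C hC =>
    Finset.card_pos.mp (by rw [card_of_mem_blockClasses κ hq hκ hC]; exact hq.pos)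
  let rep : Finset ι → ι := fun C => if h : C.Nonempty then h.choose else uu 0
  have hrep : ∀ C ∈ blockClasses κ q, rep C ∈ C := by
    intro C hC
    simp only [rep, dif_pos (hne_cls C hC)]
    exact (hne_cls C hC).choose_spec
  have hcount := card_fixed_add_classes κ hq hκ
  rw [hι] at hcount
  have hk4 : (blockClasses κ q).card ≤ 4 := by
    by_contra h5
    have : 5 * q ≤ (blockClasses κ q).card * q := Nat.mul_le_mul_right q (by omega)
    omega
  rcases Nat.lt_or_ge (blockClasses κ q).card 3 with h3 | h3
  · rcases Nat.lt_or_ge (blockClasses κ q).card 2 with h2 | h2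
    · have hk : (blockClasses κ q).card = 1 := by omega
      rw [hk] at hcount
      exact case_one' hH haut hq hodd hκ uu huu hfix rep hrep hk (by omega)
    · have hk : (blockClasses κ q).card = 2 := by omega
      rw [hk] at hcount
      exact case_two' hH haut hq hodd hκ uu huu hfix rep hrep hk (by omega)
  · rcases Nat.lt_or_ge (blockClasses κ q).card 4 with h4 | h4
    · have hk : (blockClasses κ q).card = 3 := by omega
      rw [hk] at hcount
      exact case_three' hH haut hq hodd hκ uu huu hfix rep hrep hk (by omega)
    · have hk : (blockClasses κ q).card = 4 := by omega
      rw [hk] at hcount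
      exact case_four' hH haut hq hodd hκ uu huu hfix rep hrep hk (by omega)

/-- **Order `q` in a Hadamard matrix of order `4q`, `q ≥ 5` prime: no fixed rows, no fixed columns, `4 + 4` orbits.** -/
theorem hadamard4q_fixedRows (hH : IsHadamardMatrix H) (q : ℕ) (hq : q.Prime) (hq5 : 5 ≤ q)
    (hι : Fintype.card ι = 4 * q) (π κ : Equiv.Perm ι) (d e : ι → ℤ) (haut : IsSignedAut H π κ d e)
    (hπ : π ^ q = 1) (hκ : κ ^ q = 1) (hne : π ≠ 1 ∨ κ ≠ 1) :
    (univ.filter fun i => π i = i).card = 0 ∧ (univ.filter fun j => κ j = j).card = 0 ∧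
    (blockClasses π q).card = 4 ∧ (blockClasses κ q).card = 4 := by
  have hodd : Odd q := hq.odd_of_ne_two (by omega)
  have hcard : (Fintype.card ι : ℤ) ≠ 0 := by rw [hι]; push_cast; have := hq.pos; positivity
  have hT : IsHadamardMatrix Hᵀ := isHadamard_transpose hH hcard
  have hautT : IsSignedAut Hᵀ κ π e d := by
    obtain ⟨hd, he, h⟩ := haut
    refine ⟨he, hd, fun j i => ?_⟩
    rw [Matrix.transpose_apply, Matrix.transpose_apply, h i j]; ring
  have hcκ := card_fixed_add_classes κ hq hκ
  have hcπ := card_fixed_add_classes π hq hπ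
  rw [hι] at hcκ hcπ
  have hwκ : 1 ≤ (blockClasses κ q).card := by
    by_contra h0
    have hf : (univ.filter fun j => κ j = j).card = 4 * q := by
      have : (blockClasses κ q).card = 0 := by omega
      rw [this, zero_mul, add_zero] at hcκ
      exact hcκ
    have hall : (univ.filter fun j => κ j = j) = univ :=
      Finset.eq_univ_of_card _ (by rw [hf, hι])
    have hκ1 : κ = 1 := by
      ext j
      have := (Finset.mem_filter.mp (hall ▸ Finset.mem_univ j)).2
      simpa using this
    have hπ1 : π = 1 := by
      rw [hκ1] at hautT
      exact signedAut_snd_eq_one Hᵀ hT hcard hautT hodd hπ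
    rcases hne with h | h
    · exact h hπ1
    · exact h hκ1
  have hwπ : 1 ≤ (blockClasses π q).card := by
    by_contra h0
    have hf : (univ.filter fun i => π i = i).card = 4 * q := by
      have : (blockClasses π q).card = 0 := by omega
      rw [this, zero_mul, add_zero] at hcπ
      exact hcπ
    have hall : (univ.filter fun i => π i = i) = univ :=
      Finset.eq_univ_of_card _ (by rw [hf, hι])
    have hπ1 : π = 1 := by
      ext i
      have := (Finset.mem_filter.mp (hall ▸ Finset.mem_univ i)).2
      simpa using this
    have hκ1 : κ = 1 := by
      rw [hπ1] at haut
      exact signedAut_snd_eq_one H hH hcard haut hodd hκ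
    rcases hne with h | h
    · exact h hπ1
    · exact h hκ1
  have h4r := hadamard4q_fixedRows_le_four hH hq (by omega) hι haut hκ hwκ
  have h4c := hadamard4q_fixedRows_le_four hT hq (by omega) hι hautT hπ hwπ
  -- f = (4 − w) q with f ≤ 4 < q: w = 4 and f = 0 on both sides
  have hwκ4 : (blockClasses κ q).card ≤ 4 := by
    by_contra h5
    have : 5 * q ≤ (blockClasses κ q).card * q := Nat.mul_le_mul_right q (by omega)
    omega
  have hwπ4 : (blockClasses π q).card ≤ 4 := by
    by_contra h5
    have : 5 * q ≤ (blockClasses π q).card * q := Nat.mul_le_mul_right q (by omega)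
    omega
  have hκ4 : (blockClasses κ q).card = 4 := by
    by_contra hne4
    have hle3 : (blockClasses κ q).card ≤ 3 := by omega
    have : (blockClasses κ q).card * q ≤ 3 * q := Nat.mul_le_mul_right q hle3
    omega
  have hπ4 : (blockClasses π q).card = 4 := by
    by_contra hne4
    have hle3 : (blockClasses π q).card ≤ 3 := by omega
    have : (blockClasses π q).card * q ≤ 3 * q := Nat.mul_le_mul_right q hle3
    omega
  rw [hκ4] at hcκ
  rw [hπ4] at hcπ
  refine ⟨by omega, by omega, hπ4, hκ4⟩

end order4q

end Summit.Ventures.DiscreteObjects.Hadamard
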